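import Summits.Ventures.CertifiedManyBodySolver.Certificates.HubbardSquare_n1_obliqueStation_hf3_readers
import Summits.Ventures.CertifiedManyBodySolver.Certificates.HubbardSquare_U6_n1_tp3o10_lower_row817
import HarnessLib
import HarnessLib.Audit

/-!
# Ventures/CertifiedManyBodySolver — Certificates/HubbardSquare_n1_obliqueStation_hf3_discharge_r817.lean

HONEST FRAMING: BOOKKEEPING ONLY — the BY-VALUE hypothesis `h42v` of C-145 (hubbard-fast-reuse-2 g16, (N10) «n = 1 OBLIQUE STATION ON THE t′ = ±3/10
HALF-FILLING LOWERs -42, -44, -46», `Certificates/HubbardSquare_n1_stiffness_obliqueStation_hf3_*.lean`, readers `…_hf3_readers.lean`) IS, letter for letter,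
the landed claim node of CERTIFIED #817 (6, 1, +3/10) «M3 `GU6n1tp3o10`» (sr-mbsolver registry; lit-4 module `HubbardSquare_U6_n1_tp3o10_lower_row817.lean`, node `cert_r817_bs_GU6n1tp3o10_w3_b4_R2_ob5p2_kry1_kry2c3rel_hanK7B4D4_KN4_PR20d4_hanK8c2s_uprime : Prop :=
((-4237613040412306686287303/6044629098073145873530880 : ℚ) : ℝ) ≤ energyDensityTT' 1 (3/10) 6 1`) — so every word binding `h42v` (322 rider theorems in 56 tree files at write: the n = 1 oblique-station families hf3 (C-145), ms1 ∕ ms2, kr1, xl1,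
all carrying the hypothesis in this exact shape) is BY NAME on #817 from this file on (the C-134 / #648 pattern; companion of
`HubbardSquare_n1_obliqueStation_hf3_discharge_r681.lean` for `h46v` (#681) and of `HubbardSquare_n1_obliqueStation_xl1_K5_byName_discharge.lean` (C-197)).
CERTIFIED #817 = «eng-8 -42» (hubbard-algo-eng-8 twinchain kit j331667; sr-mbsolver-ref-3 g225 R3.462-42s; APPENDED by sr-mbsolver-op-02 g92 2026-08-31T21:08Z as ROW A
of the two-row part «-42 + t′-ANCHOR», ROW B = #818 the derived CLOSEKEY UPPER at the same key, not used here). The `t′ = −3/10` copy follows by evenness (`n1_hf3_floor_U6_tpm3o10_of_v`).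
No word, no numeral, no new claim node, no definition, no `sorry`; not a registry row; no summit statement is proved by this seat.
-/

noncomputable section

namespace Summit.Ventures.CertifiedManyBodySolver.Certificates

open Literature.MathematicalPhysics.QuantumLattice
open Literature.MathematicalPhysics.QuantumLattice.ThermodynamicLimit

/-- `h42v` BY NAME: the claim node of CERTIFIED #817 is the inequality `-4237613040412306686287303/(5·2⁸⁰) ≤ e(1, 3/10, 6, 1)` itself. [cite: Griffiths1966, §II] -/
theorem n1_hf3_h42v_of_node (h : cert_r817_bs_GU6n1tp3o10_w3_b4_R2_ob5p2_kry1_kry2c3rel_hanK7B4D4_KN4_PR20d4_hanK8c2s_uprime) :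
    (((-4237613040412306686287303/6044629098073145873530880 : ℚ)) : ℝ) ≤ energyDensityTT' 1 (3/10) 6 1 := h

/-- The same row read at `t′ = −3/10` BY NAME (evenness at half filling, `n1_hf3_floor_U6_tpm3o10_of_v`). [cite: LiebWuPhysicaA2003, §1 eq. (3)] -/
theorem n1_hf3_floor_U6_tpm3o10_of_node (h : cert_r817_bs_GU6n1tp3o10_w3_b4_R2_ob5p2_kry1_kry2c3rel_hanK7B4D4_KN4_PR20d4_hanK8c2s_uprime) :
    (((-4237613040412306686287303/6044629098073145873530880 : ℚ)) : ℝ) ≤ energyDensityTT' 1 (-3/10) 6 1 :=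
  n1_hf3_floor_U6_tpm3o10_of_v (n1_hf3_h42v_of_node h)

end Summit.Ventures.CertifiedManyBodySolver.Certificates

end
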